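import Literature.Computability.FineGrained.SatAlgorithmsProofs
import Literature.Computability.Complexity.ListFoldChecks
import Literature.Computability.Complexity.FPStringBricks
import Literature.Computability.Complexity.DTIMESubsetNTIME
import Literature.Computability.Complexity.TimeBoundsComplProofs
import Mathlib.Tactic.DeriveFintype
import HarnessLib

/-!
# Fine-grained complexity — proofs: a deterministic `k`-SAT algorithm is a nondeterministic
# `k`-TAUT algorithm (discharge of `kTAUTInNExpTime_of_kSATInExpTime`)

Topic `Literature/Computability/FineGrained`; second companion ("sibling proof file", D-0014) of
`SatAlgorithms.lean` (the first is `SatAlgorithmsProofs.lean`, fine-grained.S22). It discharges the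
named fact

* `Literature.Computability.FineGrained.kTAUTInNExpTime_of_kSATInExpTime`:
  `KSATInExpTime k δ → KTAUTInNExpTime k δ` — k-SAT ∈ TIME(`2^{δ n} · poly(L)`) (a `Γ'`-machine of
  `FineGrainedWave0.lean` on `KCNF.encode`) puts k-TAUT in NTIME(`2^{δ n} · poly(L)`) (the
  guess-and-verify pattern of `SatAlgorithms.lean`: a `Bool`-machine on `boolPair (encodeBool φ) y`),

as `kTAUTInNExpTime_of_kSATInExpTime_holds`.

Source. Carmosino–Gao–Impagliazzo–Mihajlin–Paturi–Schneider, *Nondeterministic extensions of the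
Strong Exponential Time Hypothesis and consequences for non-reducibility*, ITCS 2016, §1: "NSETH: For
every `ε > 0`, there exists a `k` so that k-taut is not in NTIME[`2^{n(1−ε)}`], where k-taut is the
language of all k-dnf which are tautologies"; the implication discharged here ("co-nondeterminism is
at least as strong as determinism", whence NSETH ⇒ SETH) is the folklore inclusion
DTIME ⊆ NTIME ∩ coNTIME in the printed form of Arora–Barak 2009, Claim 2.4 ("take `p(x)` the zero
polynomial (in other words, `u` is an empty string)": a deterministic decider is a verifier that
ignores its certificate), combined with Cook 1971, §1: a DNF is a tautology iff its literal-wise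
negation, a CNF on the same variables, is unsatisfiable.

## Proof architecture (no Turing machine is written; everything is assembled from the tree's toolkit)

1. **Semantics.** `KTaut.negate φ` flips every polarity; `φ.IsDNFTautology ↔ ¬ (negate φ).Satisfiable`
   (`KTaut.isDNFTautology_iff_not_satisfiable_negate`).
2. **The transcoder** `KTaut.transFn : List Bool → List Γ'` with
   `transFn (encodeBool φ) = KCNF.encode (negate φ)` (`KTaut.transFn_encodeBool`), polynomial time
   (`KTaut.polyTime_transFn`). It is a brick assembly in the `FP` string algebra: the clause list
   `encodingCNF.encode clauses = ⟨1^m, ⟨c₁, ⟨c₂, …⟩⟩⟩` is folded by `Brick.foldFn`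
   (`ListFoldBricks.lean`) appending, per clause code, the 3-bit block code (`KTaut.code3`) of
   `Γ'.bra`, the fold over its literal codes `⟨binary i, [b]⟩ ↦ code3 (bit ¬b) · code3-digits of i ·
   code3 comma` (two one-state transducers `polT`, `digT` behind the pair projections), and `code3 ket`;
   a last transducer `finT : FST _ Bool Γ'` turns `⟨binary n, blocks⟩` into
   `binary n · comma · decoded blocks = KCNF.encode (negate φ)`. The growth hypotheses of `foldFn_mem_FP`
   hold on ALL strings (`length_litFn_le`: `≤ 3|u|`; `length_litsFn_le`: `≤ 3|a|/2`).
3. **The decider** on `encodeBool φ`: transcoder, then the given SAT machine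
   (`Turing.TM2ComputableAux.comp`, additive time, `TimeBoundsProofs.lean`), answer flipped for free by
   relabelling the output alphabet along `not` (`OutputsWithin.outputAlphabet_trans`,
   `TimeBoundsComplProofs.lean`).
4. **The verifier** on `boolPair (encodeBool φ) y`: the truncating wrapper `truncMapAux N` of the clock
   `N : x ↦ ⟨x, ε⟩` (`TruncMapMachine.lean`; it discards the ignored certificate two symbols per step,
   as the one-constant time/witness budget of `KTAUTInNExpTime` requires), composed with the decider
   behind the pair projection (`boolUnpairFstLift`, `NondeterministicProofs.lean`) — verbatim the
   architecture of `mem_NTIME_of_timeDecidable` (`DTIMESubsetNTIME.lean`). The relation is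
   `R φ y = [φ ∈ k-TAUT]`; the empty witness always suffices.
5. **Time.** On `⟨x, y⟩`, `x = encodeBool φ` of length `L`, the verifier takes
   `A φ + |y|/2` steps, `A φ = T n L_ψ + poly(L)` (`ψ = negate φ`, `L_ψ ≤ L + D · p(L)` by the push bound
   of the transcoder machine). With `T n L ≤ c 2^{δ n} (L+1)^c` and `1 ≤ T n L_ψ` (a machine needs a
   step, `KTaut.one_le_of_outputsWithin`) one gets `2 A φ ≤ R(L) · 2^{δ n}` for a polynomial `R`
   (`KTaut.budget_le`) — for every sign of `δ` — and the budget `T' n L = ⌊R(L) 2^{δ n}⌋` is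
   `IsExpPolyBound δ` and dominates `A φ + |y|/2` for `|y| ≤ T' n L` (`KTaut.kTAUTInNExpTime_of_verifier`).

## References

* M. Carmosino, J. Gao, R. Impagliazzo, I. Mihajlin, R. Paturi, S. Schneider, *Nondeterministic
  extensions of the Strong Exponential Time Hypothesis and consequences for non-reducibility*,
  ITCS 2016, 261–270, §1 (NSETH; k-TAUT) [key `CarmosinoEtAl2016` (the interim stub key of the fact's
  docstring is `CGIMPS2016`); held as `paper:doi-10-1145-2840728-2840746`, read]. doi:10.1145/2840728.2840746
* S. Arora, B. Barak, *Computational Complexity: A Modern Approach*, CUP 2009, Claim 2.4 (`P ⊆ NP`: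
  ignore the certificate), §1.3 (machine composition), §0.1 (codes).
* S. A. Cook, *The complexity of theorem-proving procedures*, Proc. 3rd STOC (1971), §1 (a formula is
  a tautology iff its negation is unsatisfiable).
* R. Impagliazzo, R. Paturi, *On the complexity of k-SAT*, JCSS 62 (2001), §1 (the time classes
  `2^{δ n} · poly(L)`).
-/

namespace Literature.Computability.FineGrained

open _root_.Computability Turing Complexity Complexity.Brick Polynomial

namespace KTaut

variable {k : ℕ}

/-! ### Semantics: a DNF is a tautology iff its literal-wise negation is unsatisfiable -/

/-- The literal-wise negation of a `k`-CNF (same variables, same clause shape, every polarity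
flipped): read as a CNF it is unsatisfiable iff the original clause list, read as a `k`-DNF, is a
tautology. [cite: Cook1971, §1] -/
def negate (φ : KCNF k) : KCNF k where
  numVars := φ.numVars
  clauses := φ.clauses.map fun c => c.map fun l => (l.1, !l.2)
  fst_lt_numVars := by
    intro c hc l hl
    obtain ⟨c₀, hc₀, rfl⟩ := List.mem_map.1 hc
    obtain ⟨l₀, hl₀, rfl⟩ := List.mem_map.1 hl
    exact φ.fst_lt_numVars c₀ hc₀ l₀ hl₀
  length_le := by
    intro c hc
    obtain ⟨c₀, hc₀, rfl⟩ := List.mem_map.1 hc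
    simpa using φ.length_le c₀ hc₀

/-- `negate` keeps the number of variables. [folklore] -/
@[simp] theorem numVars_negate (φ : KCNF k) : (negate φ).numVars = φ.numVars := rfl

/-- The clauses of `negate φ`. [folklore] -/
theorem clauses_negate (φ : KCNF k) :
    (negate φ).clauses = φ.clauses.map fun c => c.map fun l => (l.1, !l.2) := rfl

/-- **A `k`-DNF is a tautology iff its literal-wise negation is an unsatisfiable `k`-CNF**
(Cook 1971, §1: "a formula is a tautology if and only if its negation is unsatisfiable", with
De Morgan). [cite: Cook1971, §1] -/
theorem isDNFTautology_iff_not_satisfiable_negate (φ : KCNF k) :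
    φ.IsDNFTautology ↔ ¬ (negate φ).Satisfiable := by
  rw [KCNF.isDNFTautology_iff, SatTaut.satisfiable_iff_exists_eval, not_exists]
  refine forall_congr' fun w => ?_
  have key : (negate φ).eval w = true ↔ ∀ c ∈ φ.clauses, ∃ l ∈ c, w l.1 = !l.2 := by
    simp only [KCNF.eval, clauses_negate, List.all_map, List.any_map, List.all_eq_true,
      List.any_eq_true, Function.comp_apply, beq_iff_eq]
  rw [key]
  push Not
  refine exists_congr fun c => and_congr_right fun _ => forall₂_congr fun l _ => ?_
  cases w l.1 <;> cases l.2 <;> decide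

/-- The answer bit of the decider: `¬ [negate φ ∈ SAT] = true ↔ φ ∈ k-TAUT`. [folklore] -/
theorem not_decide_satisfiable_negate_iff (φ : KCNF k) :
    (!decide (negate φ).Satisfiable) = true ↔ φ.IsDNFTautology := by
  rw [isDNFTautology_iff_not_satisfiable_negate]
  simp

/-! ### The 3-bit block code of `Γ'` and three small transducers -/

/-- A 3-bit block code of Mathlib's alphabet `Γ'`. [folklore] -/
def code3 : Γ' → List Bool
  | .bit b => [false, false, b]
  | .comma => [false, true, false]
  | .bra => [false, true, true]
  | .ket => [true, false, false]
  | .blank => [true, false, true]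

/-- Decoding a block. [folklore] -/
def decode3 : Bool → Bool → Bool → Γ'
  | false, false, b => .bit b
  | false, true, false => .comma
  | false, true, true => .bra
  | true, false, false => .ket
  | true, _, _ => .blank

/-- Every block has three bits. [folklore] -/
@[simp] theorem length_code3 (γ : Γ') : (code3 γ).length = 3 := by
  cases γ <;> rfl

/-- The length of a block-coded word. [folklore] -/
theorem length_flatMap_code3 (w : List Γ') : (w.flatMap code3).length = 3 * w.length := by
  induction w with
  | nil => rfl
  | cons γ w ih => simp [List.flatMap_cons, ih]; ring

/-- States of the final transducer: header (first/second copy of a doubled bit), body (0, 1 or 2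
bits of the current block read). [folklore] -/
inductive FinSt
  | hd0
  | hd1 (c : Bool)
  | bd0
  | bd1 (b₁ : Bool)
  | bd2 (b₁ b₂ : Bool)
  deriving DecidableEq, Fintype

/-- Transition of the final transducer. [folklore] -/
def finStep : FinSt → Bool → FinSt × List Γ'
  | .hd0, c => (.hd1 c, [])
  | .hd1 c, c' => if c' = c then (.hd0, [Γ'.bit c]) else (.bd0, [Γ'.comma])
  | .bd0, b => (.bd1 b, [])
  | .bd1 b₁, b₂ => (.bd2 b₁ b₂, [])
  | .bd2 b₁ b₂, b₃ => (.bd0, [decode3 b₁ b₂ b₃])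

/-- **The final transducer** `⟨binary n, blocks⟩ ↦ binary n · comma · decoded blocks` (from `Bool`
to `Γ'`): doubled bits `bb` of the first component become `Γ'.bit b`, the separator `01` becomes
`Γ'.comma`, then every 3-bit block is decoded. [folklore] -/
def finT : FST FinSt Bool Γ' where
  init := .hd0
  step := finStep
  front := fun _ => []
  keep := fun _ => true

/-- One block through the body phase. [folklore] -/
theorem finT_run_code3 (γ : Γ') (z : List Bool) :
    finT.run .bd0 (code3 γ ++ z) = ((finT.run .bd0 z).1, γ :: (finT.run .bd0 z).2) := by
  rcases γ with _ | b | _ | _ | _ <;> simp [code3, FST.run_cons, finT, finStep, decode3]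

/-- The body phase decodes block-coded words. [folklore] -/
theorem finT_run_body (w : List Γ') : finT.run .bd0 (w.flatMap code3) = (.bd0, w) := by
  induction w with
  | nil => rfl
  | cons γ w ih => rw [List.flatMap_cons, finT_run_code3, ih]

/-- The header phase copies the doubled bits, the separator becomes a comma. [folklore] -/
theorem finT_run_header (l : List Bool) (z : List Bool) :
    finT.run .hd0 (boolPair l z) = ((finT.run .bd0 z).1, l.map Γ'.bit ++ Γ'.comma :: (finT.run .bd0 z).2) := by
  induction l with
  | nil => simp [boolPair, FST.run_cons, finT, finStep]
  | cons b l ih =>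
    have hc : boolPair (b :: l) z = b :: b :: boolPair l z := by simp [boolPair]
    rw [hc, FST.run_cons, FST.run_cons]
    have h1 : finT.step .hd0 b = (.hd1 b, []) := rfl
    have h2 : finT.step (.hd1 b) b = (.hd0, [Γ'.bit b]) := by simp [finT, finStep]
    rw [h1, h2, ih]
    simp

/-- **Semantics of `finT`.** [folklore] -/
theorem finT_eval (l : List Bool) (w : List Γ') :
    finT.eval (boolPair l (w.flatMap code3)) = l.map Γ'.bit ++ Γ'.comma :: w := by
  have h : finT.eval (boolPair l (w.flatMap code3)) = (finT.run .hd0 (boolPair l (w.flatMap code3))).2 := by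
    simp [FST.eval, finT]
  rw [h, finT_run_header, finT_run_body]

/-- Transition of the polarity transducer (state `true` = nothing read yet). [folklore] -/
def polStep (s b : Bool) : Bool × List Bool := if s then (false, code3 (Γ'.bit !b)) else (false, [])

/-- **The polarity transducer**: on a nonempty string `b · …` emit the block of `Γ'.bit (¬ b)`,
nothing else (nothing on `ε`). [folklore] -/
def polT : FST Bool Bool Bool where
  init := true
  step := polStep
  front := fun _ => []
  keep := fun _ => true

/-- After the first symbol `polT` is silent. [folklore] -/
theorem polT_run_false (l : List Bool) : polT.run false l = (false, []) := by
  induction l with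
  | nil => rfl
  | cons b l ih => rw [FST.run_cons, show polT.step false b = (false, []) from rfl, ih]; rfl

/-- `polT` on the empty string. [folklore] -/
@[simp] theorem polT_eval_nil : polT.eval [] = [] := by simp [FST.eval, polT]

/-- `polT` on a nonempty string. [folklore] -/
@[simp] theorem polT_eval_cons (b : Bool) (l : List Bool) : polT.eval (b :: l) = code3 (Γ'.bit !b) := by
  have h : polT.eval (b :: l) = (polT.run true (b :: l)).2 := by simp [FST.eval, polT]
  rw [h, FST.run_cons, show polT.step true b = (false, code3 (Γ'.bit !b)) from rfl, polT_run_false]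
  simp

/-- `polT` emits at most three bits, and nothing on `ε`: `|polT.eval s| ≤ 3 |s|`. [folklore] -/
theorem length_polT_eval_le (s : List Bool) : (polT.eval s).length ≤ 3 * s.length := by
  cases s with
  | nil => simp
  | cons b s => simp

/-- **The digit transducer**: every bit `d` becomes the block of `Γ'.bit d`. [folklore] -/
def digT : FST Unit Bool Bool where
  init := ()
  step := fun _ b => ((), code3 (Γ'.bit b))
  front := fun _ => []
  keep := fun _ => true

/-- Semantics of `digT`. [folklore] -/
@[simp] theorem digT_eval (l : List Bool) : digT.eval l = (l.map Γ'.bit).flatMap code3 := by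
  have h : ∀ l : List Bool, (digT.run () l).2 = (l.map Γ'.bit).flatMap code3 := by
    intro l
    induction l with
    | nil => rfl
    | cons b l ih =>
      rw [FST.run_cons, show digT.step () b = ((), code3 (Γ'.bit b)) from rfl]
      simp [ih]
  have he : digT.eval l = (digT.run () l).2 := by simp [FST.eval, digT]
  rw [he, h]

/-- `|digT.eval l| = 3 |l|`. [folklore] -/
theorem length_digT_eval (l : List Bool) : (digT.eval l).length = 3 * l.length := by
  rw [digT_eval, length_flatMap_code3, List.length_map]

/-! ### The transcoder in the `FP` string algebra -/

/-- A left fold appending images is a `flatMap`. [folklore] -/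
theorem foldl_append_eq {α β : Type} (f : α → List β) (l : List α) (init : List β) :
    l.foldl (fun acc a => acc ++ f a) init = init ++ l.flatMap f := by
  induction l generalizing init with
  | nil => simp
  | cons a l ih => rw [List.foldl_cons, ih, List.flatMap_cons, List.append_assoc]

/-- **The literal transform** on a nonempty string `u = ⟨binary i, b…⟩`: the block of the flipped
polarity, the blocks of the digits of `i`, the block of a comma. [folklore] -/
noncomputable def litCore (u : List Bool) : List Bool :=
  (polT.eval (sndF u) ++ digT.eval (fstF u)) ++ code3 Γ'.comma

/-- The literal transform, `ε ↦ ε` (so that its growth is at most `3 |u|` on every string).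
[folklore] -/
noncomputable def litFn : List Bool → List Bool := iteFn isNilFn (fun _ => []) litCore

/-- `litCore ∈ FP`. [folklore] -/
theorem litCore_mem_FP : litCore ∈ FP :=
  append_mem_FP (append_mem_FP (comp_mem_FP polT.polyTimeComputable_eval sndF_mem_FP)
    (comp_mem_FP digT.polyTimeComputable_eval fstF_mem_FP)) (const_mem_FP _)

/-- `litFn ∈ FP`. [folklore] -/
theorem litFn_mem_FP : litFn ∈ FP := iteFn_mem_FP isNilFn_mem_FP (const_mem_FP _) litCore_mem_FP

/-- `litFn ε = ε`. [folklore] -/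
@[simp] theorem litFn_nil : litFn [] = [] := by
  rw [litFn, iteFn_apply_true (by simp [isNilFn])]

/-- `litFn = litCore` on nonempty strings. [folklore] -/
theorem litFn_of_ne_nil {u : List Bool} (hu : u ≠ []) : litFn u = litCore u := by
  rw [litFn, iteFn_apply_false (by simp [isNilFn, hu])]

/-- **Value of the literal transform on a literal code** `⟨binary i, [b]⟩`: the block code of the
`Γ'`-encoding of the flipped literal `(i, ¬b)`. [folklore] -/
theorem litFn_encode (l : ℕ × Bool) :
    litFn (encodingLiteral.encode l) = (KCNF.encodeLiteral (l.1, !l.2)).flatMap code3 := by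
  have he : encodingLiteral.encode l = boolPair (encodeNat l.1) [l.2] := rfl
  rw [he, litFn_of_ne_nil (by simp [boolPair]), litCore, fstF_boolPair, sndF_boolPair, polT_eval_cons,
    digT_eval, KCNF.encodeLiteral]
  simp

/-- **Growth of the literal transform**: `|litFn u| ≤ 3 |u|` on every string. [folklore] -/
theorem length_litFn_le (u : List Bool) : (litFn u).length ≤ 3 * u.length := by
  by_cases hu : u = []
  · subst hu; simp
  rw [litFn_of_ne_nil hu, litCore]
  simp only [List.length_append, length_code3, length_digT_eval]
  have h1 := length_polT_eval_le (sndF u)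
  have h2 := length_fstF_sndF_le u
  have h3 := length_sndF_lt hu
  rcases Nat.eq_zero_or_pos (fstF u).length with h0 | h0 <;> omega

/-- One round of the literal fold: append the transform of the item. [folklore] -/
noncomputable def litStep (v : List Bool) : List Bool := sndPow 1 v ++ litFn (nthF 1 v)

/-- `litStep ∈ FP`. [folklore] -/
theorem litStep_mem_FP : litStep ∈ FP :=
  append_mem_FP (sndPow_mem_FP 1) (comp_mem_FP (g := litFn) (f := nthF 1) litFn_mem_FP (nthF_mem_FP 1))

/-- `litStep` on a step argument `⟨u, ⟨a, acc⟩⟩`. [folklore] -/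
@[simp] theorem litStep_apply (u a acc : List Bool) :
    litStep (boolPair u (boolPair a acc)) = acc ++ litFn a := by
  simp [litStep, sndPow, nthF]

/-- Growth of the literal round (`FoldGrowth 0`). [folklore] -/
theorem foldGrowth_litStep : FoldGrowth 0 litStep := by
  intro v
  have h := length_litFn_le (fstF (sndF v))
  simp only [litStep, sndPow, nthF, Function.comp_apply, List.length_append, zero_mul, add_zero]
  omega

/-- **The literals part**: fold `litStep` over the items of (the second component of) a clause
code. [folklore] -/
noncomputable def litsFn : List Bool → List Bool := foldFn litStep fun _ => []

/-- `litsFn ∈ FP`. [folklore] -/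
theorem litsFn_mem_FP : litsFn ∈ FP := foldFn_mem_FP litStep_mem_FP (const_mem_FP _) foldGrowth_litStep

/-- Value of `litsFn` on every string: the concatenated transforms of the items. [folklore] -/
theorem litsFn_apply (a : List Bool) : litsFn a = (decNil (sndF a)).flatMap litFn := by
  rw [litsFn, foldFn_apply]
  simp only [litStep_apply]
  rw [foldl_append_eq, List.nil_append]

/-- **Value of `litsFn` on a clause code.** [folklore] -/
theorem litsFn_encode (c : List (ℕ × Bool)) :
    litsFn (encodingClause.encode c) = (c.flatMap fun l => KCNF.encodeLiteral (l.1, !l.2)).flatMap code3 := by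
  rw [encodingClause, listBool_encode_eq_encList, litsFn_apply, sndF_boolPair, decNil_encList, List.flatMap_map,
    List.flatMap_assoc]
  congr 1
  funext l
  exact litFn_encode l

/-- **Growth of `litsFn`**: `2 |litsFn a| ≤ 3 |a|` on every string. [folklore] -/
theorem length_litsFn_le (a : List Bool) : 2 * (litsFn a).length ≤ 3 * a.length := by
  rw [litsFn_apply, List.length_flatMap]
  have h1 : ((decNil (sndF a)).map fun u => (litFn u).length).sum ≤
      ((decNil (sndF a)).map fun u => 3 * u.length).sum :=
    List.sum_le_sum fun u _ => length_litFn_le u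
  have h2 := sum_decNil_le (sndF a)
  have h3 : ((decNil (sndF a)).map fun u => 3 * u.length).sum = 3 * ((decNil (sndF a)).map fun u => u.length).sum := by
    rw [List.sum_map_mul_left]
  have h4 : ((decNil (sndF a)).map fun u => 2 * u.length).sum = 2 * ((decNil (sndF a)).map fun u => u.length).sum := by
    rw [List.sum_map_mul_left]
  have h5 := length_fstF_sndF_le a
  omega

/-- **The clause transform**: bracket blocks around the literals part. [folklore] -/
noncomputable def clauseFn (a : List Bool) : List Bool := (code3 Γ'.bra ++ litsFn a) ++ code3 Γ'.ket

/-- `clauseFn ∈ FP`. [folklore] -/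
theorem clauseFn_mem_FP : clauseFn ∈ FP :=
  append_mem_FP (append_mem_FP (const_mem_FP _) litsFn_mem_FP) (const_mem_FP _)

/-- **Value of the clause transform on a clause code**: the block code of the `Γ'`-encoding of the
negated clause. [folklore] -/
theorem clauseFn_encode (c : List (ℕ × Bool)) :
    clauseFn (encodingClause.encode c) = (KCNF.encodeClause (c.map fun l => (l.1, !l.2))).flatMap code3 := by
  rw [clauseFn, litsFn_encode, KCNF.encodeClause, List.flatMap_map]
  simp [code3]

/-- Growth of the clause transform: `|clauseFn a| ≤ 4 |a| + 6`. [folklore] -/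
theorem length_clauseFn_le (a : List Bool) : (clauseFn a).length ≤ 4 * a.length + 6 := by
  have h := length_litsFn_le a
  simp only [clauseFn, List.length_append, length_code3]
  omega

/-- One round of the clause fold. [folklore] -/
noncomputable def clauseStep (v : List Bool) : List Bool := sndPow 1 v ++ clauseFn (nthF 1 v)

/-- `clauseStep ∈ FP`. [folklore] -/
theorem clauseStep_mem_FP : clauseStep ∈ FP :=
  append_mem_FP (sndPow_mem_FP 1) (comp_mem_FP (g := clauseFn) (f := nthF 1) clauseFn_mem_FP (nthF_mem_FP 1))

/-- `clauseStep` on a step argument. [folklore] -/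
@[simp] theorem clauseStep_apply (u a acc : List Bool) :
    clauseStep (boolPair u (boolPair a acc)) = acc ++ clauseFn a := by
  simp [clauseStep, sndPow, nthF]

/-- Growth of the clause round (`FoldGrowth 6`). [folklore] -/
theorem foldGrowth_clauseStep : FoldGrowth 6 clauseStep := by
  intro v
  have h := length_clauseFn_le (fstF (sndF v))
  simp only [clauseStep, sndPow, nthF, Function.comp_apply, List.length_append]
  nlinarith

/-- **The body transform**: fold `clauseStep` over the clause codes. [folklore] -/
noncomputable def bodyFn : List Bool → List Bool := foldFn clauseStep fun _ => []

/-- `bodyFn ∈ FP`. [folklore] -/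
theorem bodyFn_mem_FP : bodyFn ∈ FP := foldFn_mem_FP clauseStep_mem_FP (const_mem_FP _) foldGrowth_clauseStep

/-- **Value of the body transform on a CNF code**: the block code of the `Γ'`-encoding of the
negated clauses. [folklore] -/
theorem bodyFn_encode (cs : List (List (ℕ × Bool))) :
    bodyFn (encodingCNF.encode cs) =
      (cs.flatMap fun c => KCNF.encodeClause (c.map fun l => (l.1, !l.2))).flatMap code3 := by
  rw [encodingCNF, listBool_encode_eq_encList, bodyFn, foldFn_apply, sndF_boolPair, decNil_encList]
  simp only [clauseStep_apply]
  rw [foldl_append_eq, List.nil_append, List.flatMap_map, List.flatMap_assoc]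
  congr 1
  funext c
  exact clauseFn_encode c

/-- The argument of the final transducer: `⟨first component, body transform of the second⟩`.
[folklore] -/
noncomputable def transArg : List Bool → List Bool := fanoutFn fstF (bodyFn ∘ sndF)

/-- `transArg ∈ FP`. [folklore] -/
theorem transArg_mem_FP : transArg ∈ FP :=
  fanoutFn_mem_FP fstF_mem_FP (comp_mem_FP bodyFn_mem_FP sndF_mem_FP)

/-- **The transcoder** from the Boolean encoding of `k`-CNFs to the `Γ'`-encoding of their
negations. [folklore] -/
noncomputable def transFn : List Bool → List Γ' := finT.eval ∘ transArg

/-- **The transcoder is polynomial time** (bricks, then a transducer; `PolyTimeComputable.comp_holds`).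
[cite: AroraBarak2009, §1.3] -/
theorem polyTime_transFn : PolyTimeComputable (id : List Bool → List Bool) (id : List Γ' → List Γ') transFn :=
  PolyTimeComputable.comp_holds finT.polyTimeComputable_eval transArg_mem_FP

/-- **The transcoder computes `KCNF.encode (negate φ)` from `KCNF.encodeBool φ`.** [folklore] -/
theorem transFn_encodeBool (φ : KCNF k) : transFn φ.encodeBool = (negate φ).encode := by
  rw [transFn, Function.comp_apply, transArg, fanoutFn_apply, KCNF.encodeBool, fstF_boolPair,
    Function.comp_apply, sndF_boolPair, bodyFn_encode, finT_eval, KCNF.encode, clauses_negate,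
    List.flatMap_map]
  rfl

/-! ### Machines: every run takes a step; the budget; the verifier -/

/-- A halting run takes at least one step (the initial configuration carries the label `main`, the
halting configuration carries none). [folklore] -/
theorem one_le_of_outputsWithin {Γ₀ Γ₁ : Type} (M : TM2ComputableAux Γ₀ Γ₁) {l : List Γ₀}
    {l' : List Γ₁} {m : ℕ} (h : M.OutputsWithin l l' m) : 1 ≤ m := by
  obtain ⟨⟨⟨n, hn⟩, hnm⟩⟩ := h
  change n ≤ m at hnm
  rcases n with _ | n
  · exfalso
    have h1 : initList M.tm (l.map M.inputAlphabet.symm) = haltList M.tm (l'.map M.outputAlphabet.symm) :=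
      Option.some.inj hn
    have h2 := congrArg TM2.Cfg.l h1
    simp [initList, haltList] at h2
  · omega

/-- **The budget estimate.** If `T n L ≤ c 2^{δ n} (L+1)^c`, the run on the negation has length
parameter `Lψ` with `Lψ + 1 ≤ G(L)` and takes `T n Lψ ≥ 1` steps, and the overhead is `e ≤ P(L)`,
then `2 (T n Lψ + e) ≤ (2 (P + 1) c G^c)(L) · 2^{δ n}` — for every sign of `δ`, the factor
`2^{δ n}` on the polynomial overhead being paid for by `1 ≤ T n Lψ`. [folklore] -/
theorem budget_le {c : ℕ} {δ : ℝ} {T : ℕ → ℕ → ℕ}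
    (hc : ∀ n L : ℕ, (T n L : ℝ) ≤ c * (2 : ℝ) ^ (δ * n) * ((L : ℝ) + 1) ^ c)
    {n Lψ L e : ℕ} {G P : Polynomial ℕ} (hG : Lψ + 1 ≤ G.eval L) (h1 : 1 ≤ T n Lψ)
    (he : e ≤ P.eval L) :
    ((2 * (T n Lψ + e) : ℕ) : ℝ) ≤ (((2 * (P + 1) * (C c * G ^ c)).eval L : ℕ) : ℝ) * (2 : ℝ) ^ (δ * n) := by
  set B : ℝ := (c : ℝ) * (2 : ℝ) ^ (δ * n) * ((G.eval L : ℕ) : ℝ) ^ c with hB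
  have hG' : (Lψ : ℝ) + 1 ≤ ((G.eval L : ℕ) : ℝ) := by exact_mod_cast hG
  have hT : (T n Lψ : ℝ) ≤ B := by
    refine (hc n Lψ).trans ?_
    rw [hB]
    gcongr
  have hB1 : (1 : ℝ) ≤ B := le_trans (by exact_mod_cast h1) hT
  have heP : (e : ℝ) ≤ ((P.eval L : ℕ) : ℝ) * B := by
    have : (e : ℝ) ≤ ((P.eval L : ℕ) : ℝ) := by exact_mod_cast he
    exact this.trans (le_mul_of_one_le_right (Nat.cast_nonneg _) hB1)
  have hev : (((2 * (P + 1) * (C c * G ^ c)).eval L : ℕ) : ℝ) * (2 : ℝ) ^ (δ * n) =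
      2 * (((P.eval L : ℕ) : ℝ) + 1) * B := by
    simp only [eval_mul, eval_add, eval_pow, eval_C, eval_one, eval_ofNat]
    push_cast
    rw [hB]; ring
  rw [hev]
  push_cast
  nlinarith [hT, heP, hB1]

/-- **From a verifier to `KTAUTInNExpTime`.** A machine `V` answering `[φ ∈ k-TAUT]` on
`⟨encodeBool φ, y⟩` within `A φ + |y| / 2` steps, with `2 A φ ≤ R(L) · 2^{δ n}` for a polynomial `R`,
witnesses `KTAUTInNExpTime k δ` with the budget `T' n L = ⌊R(L) 2^{δ n}⌋`, the relation
`R φ y = [φ ∈ k-TAUT]` and the empty witness. [cite: AroraBarak2009, Claim 2.4] -/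
theorem kTAUTInNExpTime_of_verifier {δ : ℝ} (V : TM2ComputableAux Bool Bool) (A : KCNF k → ℕ)
    (R : Polynomial ℕ)
    (hA : ∀ φ : KCNF k, ((2 * A φ : ℕ) : ℝ) ≤ ((R.eval φ.encodeBool.length : ℕ) : ℝ) * (2 : ℝ) ^ (δ * φ.numVars))
    (hV : ∀ (φ : KCNF k) (y : List Bool), V.OutputsWithin (boolPair φ.encodeBool y)
      (encodeBool (!decide (negate φ).Satisfiable)) (A φ + y.length / 2)) :
    KTAUTInNExpTime k δ := by
  obtain ⟨c₁, d₁, hR⟩ := exists_eval_le_mul_pow_add R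
  refine ⟨fun n L => ⌊((R.eval L : ℕ) : ℝ) * (2 : ℝ) ^ (δ * n)⌋₊, fun φ _ => !decide (negate φ).Satisfiable, V,
    ⟨max (2 * c₁) d₁, fun n L => ?_⟩, fun φ y hy => ?_, fun φ => ?_⟩
  · -- the budget is `O(2^{δ n} poly(L))`
    refine (Nat.floor_le (by positivity)).trans ?_
    have h1 : ((R.eval L : ℕ) : ℝ) ≤ c₁ * (L : ℝ) ^ d₁ + c₁ := by exact_mod_cast hR L
    have hL1 : (1 : ℝ) ≤ (L : ℝ) + 1 := by simp
    have hmax : ((2 * c₁ : ℕ) : ℝ) ≤ ((max (2 * c₁) d₁ : ℕ) : ℝ) := by exact_mod_cast le_max_left _ _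
    have h2 : ((R.eval L : ℕ) : ℝ) ≤ ((max (2 * c₁) d₁ : ℕ) : ℝ) * ((L : ℝ) + 1) ^ (max (2 * c₁) d₁) :=
      calc ((R.eval L : ℕ) : ℝ) ≤ c₁ * (L : ℝ) ^ d₁ + c₁ := h1
        _ ≤ c₁ * ((L : ℝ) + 1) ^ d₁ + c₁ * ((L : ℝ) + 1) ^ d₁ := by
            gcongr
            · linarith
            · exact le_mul_of_one_le_right (Nat.cast_nonneg _) (one_le_pow₀ hL1)
        _ = ((2 * c₁ : ℕ) : ℝ) * ((L : ℝ) + 1) ^ d₁ := by push_cast; ring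
        _ ≤ ((max (2 * c₁) d₁ : ℕ) : ℝ) * ((L : ℝ) + 1) ^ (max (2 * c₁) d₁) :=
            mul_le_mul hmax (pow_le_pow_right₀ hL1 (le_max_right _ _)) (by positivity) (by positivity)
    calc ((R.eval L : ℕ) : ℝ) * (2 : ℝ) ^ (δ * n)
        ≤ ((max (2 * c₁) d₁ : ℕ) : ℝ) * ((L : ℝ) + 1) ^ (max (2 * c₁) d₁) * (2 : ℝ) ^ (δ * n) := by
          gcongr
      _ = ((max (2 * c₁) d₁ : ℕ) : ℝ) * (2 : ℝ) ^ (δ * n) * ((L : ℝ) + 1) ^ (max (2 * c₁) d₁) := by ring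
  · -- the run, within the budget
    refine (hV φ y).mono ?_
    dsimp only at hy ⊢
    have h2A : 2 * A φ ≤ ⌊((R.eval φ.encodeBool.length : ℕ) : ℝ) * (2 : ℝ) ^ (δ * φ.numVars)⌋₊ :=
      Nat.le_floor (hA φ)
    omega
  · -- correctness: the empty witness
    rw [← not_decide_satisfiable_negate_iff]
    exact ⟨fun h => ⟨[], Nat.zero_le _, h⟩, fun ⟨_, _, h⟩ => h⟩

end KTaut

open KTaut in
/-- **Discharge of `kTAUTInNExpTime_of_kSATInExpTime`: a deterministic `k`-SAT algorithm in time
`2^{δ n} · poly(L)` gives a nondeterministic `k`-TAUT algorithm with the same exponent** — the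
verifier ignores its certificate (discarding it two symbols per step), transcodes the Boolean
instance `⟨binary n, code of the clauses⟩` into the `Γ'`-word of the literal-wise negated `k`-CNF on the
same `n` variables, runs the `k`-SAT machine and flips its answer (a `k`-DNF is a tautology iff its
negation is unsatisfiable). This is the inclusion DTIME ⊆ coNTIME at the exponential scale that
makes NSETH imply SETH (Carmosino–Gao–Impagliazzo–Mihajlin–Paturi–Schneider, ITCS 2016, §1: "NSETH:
For every `ε > 0`, there exists a `k` so that k-taut is not in NTIME[`2^{n(1−ε)}`]"; the printed
machine argument is Arora–Barak 2009, Claim 2.4, with Cook 1971, §1 for the negation).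
[cite: CarmosinoEtAl2016, §1 (NSETH, k-TAUT)] [cite: AroraBarak2009, Claim 2.4] -/
theorem kTAUTInNExpTime_of_kSATInExpTime_holds : kTAUTInNExpTime_of_kSATInExpTime := by
  intro k δ h
  obtain ⟨T, ⟨c, hc⟩, M, hM⟩ := h
  have hM' : ∀ ψ : KCNF k, M.OutputsWithin ψ.encode (encodeBool (decide ψ.Satisfiable))
      (T ψ.numVars ψ.encode.length) := fun ψ => hM ψ
  obtain ⟨p, Mt, hMt⟩ := polyTime_transFn
  obtain ⟨q, N, hN⟩ := exists_machine_pair_nil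
  obtain ⟨e, he⟩ : ∃ e : Bool ≃ Bool, ⇑e = not := ⟨⟨not, not, Bool.not_not, Bool.not_not⟩, rfl⟩
  -- the decider on `encodeBool φ`: transcode, decide SAT of the negation, flip the answer
  let D : TM2ComputableAux Bool Bool :=
    ⟨(Mt.comp M).tm, (Mt.comp M).inputAlphabet, (Mt.comp M).outputAlphabet.trans e⟩
  have h₁ : ∀ φ : KCNF k, Mt.OutputsWithin φ.encodeBool (negate φ).encode (p.eval φ.encodeBool.length) :=
    fun φ => by simpa [transFn_encodeBool] using hMt φ.encodeBool
  have hD : ∀ φ : KCNF k, D.OutputsWithin φ.encodeBool (encodeBool (!decide (negate φ).Satisfiable))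
      (T φ.numVars (negate φ).encode.length + p.eval φ.encodeBool.length) := by
    intro φ
    have h₂ := hM' (negate φ)
    rw [numVars_negate] at h₂
    have h₁₂ := TM2ComputableAux.comp_outputsWithin Mt M (h₁ φ) h₂
    have key : encodeBool (!decide (negate φ).Satisfiable) =
        (encodeBool (decide (negate φ).Satisfiable)).map e := by
      rw [he]; rfl
    rw [key]
    exact h₁₂.outputAlphabet_trans e
  -- the verifier on `⟨encodeBool φ, y⟩`: discard `y`, run the decider on the first component
  let V : TM2ComputableAux Bool Bool := (truncMapAux N).comp (boolUnpairFstLift D)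
  let A : KCNF k → ℕ := fun φ => T φ.numVars (negate φ).encode.length +
    (p.eval φ.encodeBool.length + q.eval φ.encodeBool.length + 7 * φ.encodeBool.length + 16)
  refine kTAUTInNExpTime_of_verifier V A
    (2 * ((p + q + C 7 * X + C 16) + 1) * (C c * (X + C (TM2Comp.machinePushBound Mt.tm) * p + 1) ^ c))
    (fun φ => ?_) (fun φ y => ?_)
  · -- the budget inequality
    refine budget_le hc ?_ ?_ ?_
    · have := (h₁ φ).length_le
      simp only [eval_add, eval_mul, eval_C, eval_X, eval_one]
      omega
    · have := one_le_of_outputsWithin M (hM' (negate φ))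
      rwa [numVars_negate] at this
    · simp only [eval_add, eval_mul, eval_C, eval_X]
      exact le_rfl
  · -- the run of the verifier
    have ht := outputsWithin_truncMapAux_boolPair N (y := y) (hN φ.encodeBool)
    simp only [List.length_nil, List.take_zero, mul_zero, add_zero] at ht
    have hd : (boolUnpairFstLift D).OutputsWithin (boolPair φ.encodeBool [])
        (encodeBool (!decide (negate φ).Satisfiable))
        (T φ.numVars (negate φ).encode.length + p.eval φ.encodeBool.length +
          ((boolPair φ.encodeBool ([] : List Bool)).length + 3)) := by
      refine outputsWithin_boolUnpairFstLift D ?_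
      simpa using hD φ
    refine (TM2ComputableAux.comp_outputsWithin _ _ ht hd).mono ?_
    simp only [length_boolPair, List.length_nil, A]
    omega

end Literature.Computability.FineGrained
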